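import Summits.AnomalousDissipation.AnomalousDissipation.Theorems.KolmogorovFloor.Negative.Rest
import Summits.AnomalousDissipation.AnomalousDissipation.Theorems.KolmogorovFloor.Negative.TwoModes
import Summits.AnomalousDissipation.AnomalousDissipation.Theorems.KolmogorovFloor.Negative.EndgameRest

/-!
# Band-limited floors need resolution: the beat at rest (negative side of `KolmogorovFloor`, stmt-14030)

cdisprove seat `refuter-cdisprove-stmt-AnomalousDissipation-14030-0` (2026-08-16).

The crux `KolmogorovFloor` is the `β = 3/4` member of the family of band-limited FLOOR certificate classes
`N ≤ C ν^{-β}`. This file refutes the low-resolution members UNCONDITIONALLY, for every force: no `ν`-uniform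
floor with test fields of degree `N ≤ C ν^{-1/6}` exists (`not_floor_sixth`), hence (monotonicity in `β`, see
the crux workfile `Cruxes/KolmogorovFloor/Disproof.lean`) none with `β ≤ 1/6`. Mechanism ("beat at rest"):
at rest the floor forces the multiplier `G = Φ₁'(0)` to inject, `ε₀ ≤ (f, G) ≤ ‖f‖₂ √#ball · max_k ‖Ĝ(k)‖`;
two plane waves above the resolution (invisible to the coordinates, so `Φ₁'` stays `G`) beating at the
largest resolved coefficient `q` of `G` lower the generator pairing by `π α² |q| |ζ| ≥ 2(‖f‖₂√#ball + 1)‖Ĝ(q)‖`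
at viscous price `O((1+2Θ) ν (N²+2N+5)² α²)`, and the SIGN of the waves disposes of the energy channel; with
`ν = s⁻¹²`, `N ≤ C s²` the price is `O(s⁻¹)` — contradiction for `s` large. The exponent `1/6` is what the
landed lattice (`wave_frequencies`: `|p| ≤ N² + 2N + 5`) and `ℓ²`-over-the-ball bookkeeping give; the paper
reach of the same mechanism is every `β < 1/2` (Wiener norm of `f`, carrier `|p| ≍ N`), and one Beltrami–Nash
stage reaches every `β < 3/4` (crux workfile, (F4)/(F6)).
Support: `Negative/{Rest, TwoModes, EndgameRest}.lean`; toolkit `Theorems/TaylorCertificatePair/Negative/*`.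
-/

noncomputable section

open MeasureTheory UnitAddTorus Matrix
open scoped InnerProductSpace ENNReal ComplexConjugate

namespace Summit.AnomalousDissipation.AnomalousDissipation.Theorems.KolmogorovFloor.Negative

open Literature.Analysis.FunctionSpaces Literature.Analysis.FluidPDE
open Summit.AnomalousDissipation.AnomalousDissipation.Theorems.TaylorCertificatePair.Negative

/-! ### The refutation of the low-resolution floor class -/

/-- **No band-limited floor certificate of resolution `N ≤ C ν^{-1/6}` exists, for any force**
(refutation of the `β = 1/6` member of the floor class whose `β = 3/4` member is the crux `KolmogorovFloor`;
by monotonicity in `β` — lower resolution is a stronger bet — every `β ≤ 1/6` dies with it). Witness: the beat at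
rest described in the module docstring, with `ν = s⁻¹²` and `s ≥ S(‖f‖₂, ε₀, C, Θ, ν₀)` explicit. -/
theorem not_floor_sixth : ¬ (∃ f : UnitAddTorus (Fin 3) → EuclideanSpace ℝ (Fin 3), Literature.Analysis.FunctionSpaces.Torus.IsSmooth f ∧ Literature.Analysis.FunctionSpaces.Torus.IsDivFree f ∧ Literature.Analysis.FunctionSpaces.Torus.HasZeroMean f ∧ ∃ (ε₀ C Θ ν₀ : ℝ), 0 < ε₀ ∧ 0 < ν₀ ∧ ∀ ν : ℝ, 0 < ν → ν < ν₀ → ∃ (N : ℕ) (Φ₁ : Literature.Analysis.FluidPDE.Torus.CylindricalTest (Fin 3)) (θ₁ : ℝ), (N : ℝ) ≤ C * ν ^ (-(1 / 6 : ℝ)) ∧ (∀ i, Literature.Analysis.FunctionSpaces.Torus.fourierTruncate N (Φ₁.g i) = Φ₁.g i) ∧ -Θ ≤ θ₁ ∧ θ₁ ≤ 0 ∧ ∀ u : Literature.Analysis.FunctionSpaces.Torus.energySpace (Fin 3), let uf : UnitAddTorus (Fin 3) → EuclideanSpace ℝ (Fin 3) := ((u : MeasureTheory.Lp (EuclideanSpace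 ℝ (Fin 3)) 2 (MeasureTheory.volume : MeasureTheory.Measure (UnitAddTorus (Fin 3)))) : UnitAddTorus (Fin 3) → EuclideanSpace ℝ (Fin 3)); let D : ℝ := ν * (Literature.Analysis.FunctionSpaces.Torus.eGradNormSq uf).toReal; let P : ℝ := Literature.Analysis.FluidPDE.Torus.pairing (u : MeasureTheory.Lp (EuclideanSpace ℝ (Fin 3)) 2 (MeasureTheory.volume : MeasureTheory.Measure (UnitAddTorus (Fin 3)))) f - D; Literature.Analysis.FunctionSpaces.Torus.eGradNormSq uf ≠ ⊤ → ‖u‖ ^ 2 ≤ 16 * (∫ x, ‖f x‖ ^ 2) / ν ^ 2 → ε₀ ≤ D + Literature.Analysis.FluidPDE.Torus.nsGeneratorPairing ν f u (Φ₁.grad u) + 2 * θ₁ * P) := by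
  rintro ⟨f, hfs, -, -, ε₀, C, Θ, ν₀, hε₀, hν₀, hcert⟩
  have hF2nn : 0 ≤ ∫ x, ‖f x‖ ^ 2 := integral_nonneg fun x => by positivity
  /- Step 0: a vanishing force is excluded by the floor at rest. -/
  have hF2pos : 0 < ∫ x, ‖f x‖ ^ 2 := by
    refine lt_of_le_of_ne hF2nn fun hF0 => ?_
    obtain ⟨N, Φ₁, θ₁, -, -, -, -, hu⟩ := hcert (ν₀ / 2) (by positivity) (by linarith)
    have hinj := rest_injects (half_pos hν₀) hu
    have hae := ae_zero_of_integral_sq_zero hfs hF0.symm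
    have hzero : (∫ x, ⟪f x, Φ₁.grad 0 x⟫_ℝ) = 0 := by
      rw [← integral_zero (α := (UnitAddTorus (Fin 3))) (G := ℝ)]
      refine integral_congr_ae ?_
      filter_upwards [hae] with x hx
      simp [hx]
    linarith
  obtain ⟨F, hFdef⟩ : ∃ F : ℝ, F = Real.sqrt (∫ x, ‖f x‖ ^ 2) := ⟨_, rfl⟩
  have hF : 0 < F := by rw [hFdef]; exact Real.sqrt_pos.2 hF2pos
  have hFsq : F ^ 2 = ∫ x, ‖f x‖ ^ 2 := by rw [hFdef]; exact Real.sq_sqrt hF2nn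
  /- Step 1: constants and the viscosity `ν = s⁻¹²`. -/
  obtain ⟨C', hC'⟩ : ∃ C' : ℝ, C' = max C 1 := ⟨_, rfl⟩
  obtain ⟨Θ', hΘ'⟩ : ∃ Θ' : ℝ, Θ' = max Θ 0 := ⟨_, rfl⟩
  have hC'1 : 1 ≤ C' := by rw [hC']; exact le_max_right _ _
  have hΘ'0 : 0 ≤ Θ' := by rw [hΘ']; exact le_max_right _ _
  obtain ⟨K₃, hK₃⟩ : ∃ K₃ : ℝ, K₃ = Real.sqrt (27 * C' ^ 3) := ⟨_, rfl⟩
  have hK₃0 : 0 ≤ K₃ := by rw [hK₃]; exact Real.sqrt_nonneg _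
  obtain ⟨s, hsdef⟩ : ∃ s : ℝ, s = (10240 * (1 + 2 * Θ') * C' ^ 4 * (F * K₃ + 1) / ε₀ + 1) + (F * K₃ + 1) / (4 * F ^ 2) + 1 / ν₀ + 1 := ⟨_, rfl⟩
  have hS1 : 0 ≤ 10240 * (1 + 2 * Θ') * C' ^ 4 * (F * K₃ + 1) / ε₀ + 1 := by positivity
  have hS2 : 0 ≤ (F * K₃ + 1) / (4 * F ^ 2) := by positivity
  have hS3 : 0 ≤ 1 / ν₀ := by positivity
  have hs1 : 1 ≤ s := by rw [hsdef]; linarith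
  have hs0 : 0 < s := by linarith
  have hsS : 10240 * (1 + 2 * Θ') * C' ^ 4 * (F * K₃ + 1) / ε₀ + 1 ≤ s := by rw [hsdef]; linarith
  have hsB : F * K₃ + 1 ≤ 4 * F ^ 2 * s := by
    have h1 : (F * K₃ + 1) / (4 * F ^ 2) ≤ s := by rw [hsdef]; linarith
    have h4 : (0 : ℝ) < 4 * F ^ 2 := by positivity
    rw [div_le_iff₀ h4] at h1
    linarith
  have hsν : 1 / ν₀ < s := by rw [hsdef]; linarith
  obtain ⟨ν, hνdef⟩ : ∃ ν : ℝ, ν = (s ^ 12)⁻¹ := ⟨_, rfl⟩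
  have hs12pos : 0 < s ^ 12 := by positivity
  have hν : 0 < ν := by rw [hνdef]; exact inv_pos.2 hs12pos
  have hνν₀ : ν < ν₀ := by
    have hs112 : s ≤ s ^ 12 := by
      calc s = s ^ 1 := (pow_one s).symm
        _ ≤ s ^ 12 := pow_le_pow_right₀ hs1 (by norm_num)
    rw [hνdef, inv_lt_comm₀ hs12pos hν₀]
    calc ν₀⁻¹ = 1 / ν₀ := (one_div ν₀).symm
      _ < s := hsν
      _ ≤ s ^ 12 := hs112
  obtain ⟨N, Φ₁, θ₁, hN, hband, hθ₁, hθ₁', hu⟩ := hcert ν hν hνν₀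
  have hΘ : 0 ≤ Θ := by linarith
  have hΘeq : Θ' = Θ := by rw [hΘ']; exact max_eq_left hΘ
  have hNs : (N : ℝ) ≤ C' * s ^ 2 := by
    rw [hνdef, rpow_neg_sixth_inv_pow_twelve hs0] at hN
    refine hN.trans (mul_le_mul_of_nonneg_right ?_ (by positivity))
    rw [hC']; exact le_max_left _ _
  have hN0 : (0 : ℝ) ≤ N := Nat.cast_nonneg N
  /- Step 2: the multiplier at rest and its truncated norm. -/
  obtain ⟨G, hGdef⟩ : ∃ G : (UnitAddTorus (Fin 3)) → (EuclideanSpace ℝ (Fin 3)), G = Φ₁.grad 0 := ⟨_, rfl⟩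
  have hinj : ε₀ ≤ ∫ x, ⟪f x, G x⟫_ℝ := by rw [hGdef]; exact rest_injects hν hu
  have hG : Torus.IsSmooth G := by rw [hGdef]; exact isSmooth_grad Φ₁ 0
  have hbandG : ∀ κ, (N : ℝ) ^ 2 < Torus.freqNormSq κ → mFourierCoeff (EuclideanSpace.complexify ∘ G) κ = 0 := by
    rw [hGdef]; exact fc_grad_eq_zero Φ₁ hband 0
  obtain ⟨𝔊, h𝔊def⟩ : ∃ 𝔊 : ℝ, 𝔊 = (Real.sqrt (∑ κ' ∈ Torus.freqBall N, ‖mFourierCoeff (EuclideanSpace.complexify ∘ G) κ'‖ ^ 2)) := ⟨_, rfl⟩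
  have h𝔊0 : 0 ≤ 𝔊 := by rw [h𝔊def]; exact coeffNorm_nonneg N G
  have hfG : ∫ x, ⟪f x, G x⟫_ℝ ≤ F * 𝔊 := by
    have := integral_inner_le_coeffNorm (hfs.memLp 2) hG.continuous hbandG
    rwa [← hFdef, ← h𝔊def] at this
  have h𝔊pos : 0 < 𝔊 := by
    by_contra hneg
    have h' : 𝔊 ≤ 0 := not_lt.1 hneg
    have : F * 𝔊 ≤ 0 := mul_nonpos_of_nonneg_of_nonpos hF.le h'
    linarith
  /- Step 3: the largest resolved coefficient `q`. -/
  obtain ⟨q, hqmem, hqmax⟩ := Finset.exists_max_image (Torus.freqBall (d := Fin 3) N)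
    (fun κ => ‖(mFourierCoeff (EuclideanSpace.complexify ∘ G) κ)‖) ⟨0, Torus.zero_mem_freqBall N⟩
  have hcardq : 𝔊 ^ 2 ≤ (Torus.freqBall (d := Fin 3) N).card * ‖(mFourierCoeff (EuclideanSpace.complexify ∘ G) q)‖ ^ 2 := by
    rw [h𝔊def]; exact coeffNorm_sq_le_card_mul hqmax
  obtain ⟨g, hgdef⟩ : ∃ g : (EuclideanSpace ℂ (Fin 3)), g = (mFourierCoeff (EuclideanSpace.complexify ∘ G) q) := ⟨_, rfl⟩
  rw [← hgdef] at hcardq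
  have hg0 : g ≠ 0 := by
    intro h
    rw [h, norm_zero] at hcardq
    have h2 : 0 < 𝔊 ^ 2 := by positivity
    have h3 : 𝔊 ^ 2 ≤ 0 := by simpa using hcardq
    linarith
  have hq0 : q ≠ 0 := by
    rintro rfl
    apply hg0
    rw [hgdef, hGdef]
    exact fc_grad_zero Φ₁ _
  have hfqN : Torus.freqNormSq q ≤ (N : ℝ) ^ 2 := Torus.mem_freqBall.1 hqmem
  have hfq1 : 1 ≤ Torus.freqNormSq q := Torus.one_le_freqNormSq_of_ne_zero hq0
  /- Step 4: the frame and the polarisation direction. -/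
  have hgt : ((fun j => ((q) j : ℂ)) ⬝ᵥ (WithLp.ofLp (g))) = 0 := by rw [hgdef, hGdef]; exact dotc_fc_grad Φ₁ _ q
  obtain ⟨r, B, hr0, hrq, hrq2, hB1, hrB, hqB, hgB⟩ := frame_selection hq0 g hgt
  obtain ⟨ζ, hζdef⟩ : ∃ ζ : ℂ, ζ = ⟪g, EuclideanSpace.complexify B⟫_ℂ := ⟨_, rfl⟩
  rw [← hζdef] at hgB
  have hζ0 : ζ ≠ 0 := by
    intro h
    rw [h, norm_zero] at hgB
    have h2 : ‖g‖ ^ 2 ≤ 0 := by simpa using hgB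
    have h3 : ‖g‖ ^ 2 = 0 := le_antisymm h2 (sq_nonneg _)
    exact hg0 (norm_eq_zero.1 (pow_eq_zero_iff two_ne_zero |>.1 h3))
  /- Step 5: the unresolved wave frequencies. -/
  obtain ⟨t, p, hpdef, hpq, hNp, hNpq, -, -, -, -, hN5, hLp, hLpq⟩ :=
    wave_frequencies N hfqN hr0 hrq hrq2
  have hp0 : p ≠ 0 := ne_zero_of_freqNormSq_pos (sq_nonneg _) hNp
  have hpq0 : p + q ≠ 0 := ne_zero_of_freqNormSq_pos (sq_nonneg _) hNpq
  have hLm := two_freq_le (p := p) (q := q) hLp hLpq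
  /- Step 6: the amplitude and the polarisations (both signs). -/
  obtain ⟨card, hcarddef⟩ : ∃ card : ℝ, card = ((Torus.freqBall (d := Fin 3) N).card : ℝ) := ⟨_, rfl⟩
  rw [← hcarddef] at hcardq
  have hcard1 : 1 ≤ card := by
    have : 1 ≤ (Torus.freqBall (d := Fin 3) N).card := Finset.card_pos.2 ⟨0, Torus.zero_mem_freqBall N⟩
    rw [hcarddef]; exact_mod_cast this
  have hcard : card ≤ (2 * (N : ℝ) + 1) ^ 3 := by rw [hcarddef]; exact card_freqBall_le N
  have hsc : Real.sqrt card ≤ K₃ * s ^ 3 := by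
    rw [hK₃]; exact (lattice_bounds hC'1 hs1 hN0 hNs hcard).2
  obtain ⟨α, hαdef⟩ : ∃ α : ℝ, α = Real.sqrt (F * Real.sqrt card + 1) := ⟨_, rfl⟩
  have hα0 : 0 ≤ α := by rw [hαdef]; exact Real.sqrt_nonneg _
  have hα2 : α ^ 2 = F * Real.sqrt card + 1 := by
    rw [hαdef, Real.sq_sqrt]
    have : 0 ≤ Real.sqrt card := Real.sqrt_nonneg _
    positivity
  have hzA : ‖((((α) / Real.sqrt (Torus.freqNormSq (q)) : ℝ) : ℂ) • EuclideanSpace.complexify (WithLp.toLp 2 (fun i => ((q) i : ℝ))))‖ ≤ α := by rw [norm_polA hα0 hq0]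
  have hzB : ‖(((-Complex.I * conj ((ζ)) * ((‖(ζ)‖⁻¹ : ℝ) : ℂ)) * ((α) : ℂ)) • EuclideanSpace.complexify (B))‖ ≤ α := by rw [norm_polB α hα0 hζ0 hB1]
  have hdA : ((fun j => ((p) j : ℂ)) ⬝ᵥ (WithLp.ofLp (((((α) / Real.sqrt (Torus.freqNormSq (q)) : ℝ) : ℂ) • EuclideanSpace.complexify (WithLp.toLp 2 (fun i => ((q) i : ℝ))))))) = 0 := by
    rw [dotc_polA, hpq]; simp
  have hdB : ((fun j => (((p + q)) j : ℂ)) ⬝ᵥ (WithLp.ofLp ((((-Complex.I * conj ((ζ)) * ((‖(ζ)‖⁻¹ : ℝ) : ℂ)) * ((α) : ℂ)) • EuclideanSpace.complexify (B))))) = 0 := by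
    rw [dotc_polB]
    have hsum : (∑ j, ((p + q) j : ℝ) * B j) = 0 := by
      have e : ∀ j, ((p + q) j : ℝ) * B j = (t : ℝ) * ((r j : ℝ) * B j) + (q j : ℝ) * B j := by
        intro j
        rw [hpdef]
        simp only [Pi.add_apply, Int.cast_add, Int.cast_mul, Int.cast_natCast]
        ring
      simp_rw [e, Finset.sum_add_distrib, ← Finset.mul_sum, hrB, hqB]
      ring
    rw [hsum]; simp
  have hBq : ((fun j => ((q) j : ℂ)) ⬝ᵥ (WithLp.ofLp ((((-Complex.I * conj ((ζ)) * ((‖(ζ)‖⁻¹ : ℝ) : ℂ)) * ((α) : ℂ)) • EuclideanSpace.complexify (B))))) = 0 := by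
    rw [dotc_polB]
    have hsum : (∑ j, (q j : ℝ) * B j) = 0 := hqB
    rw [hsum]; simp
  have hzA' : ‖-((((α) / Real.sqrt (Torus.freqNormSq (q)) : ℝ) : ℂ) • EuclideanSpace.complexify (WithLp.toLp 2 (fun i => ((q) i : ℝ))))‖ ≤ α := by rw [norm_neg]; exact hzA
  have hzB' : ‖-(((-Complex.I * conj ((ζ)) * ((‖(ζ)‖⁻¹ : ℝ) : ℂ)) * ((α) : ℂ)) • EuclideanSpace.complexify (B))‖ ≤ α := by rw [norm_neg]; exact hzB
  have hdA' : ((fun j => ((p) j : ℂ)) ⬝ᵥ (WithLp.ofLp (-((((α) / Real.sqrt (Torus.freqNormSq (q)) : ℝ) : ℂ) • EuclideanSpace.complexify (WithLp.toLp 2 (fun i => ((q) i : ℝ))))))) = 0 := by rw [dotc_neg_right, hdA, neg_zero]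
  have hdB' : ((fun j => (((p + q)) j : ℂ)) ⬝ᵥ (WithLp.ofLp (-(((-Complex.I * conj ((ζ)) * ((‖(ζ)‖⁻¹ : ℝ) : ℂ)) * ((α) : ℂ)) • EuclideanSpace.complexify (B))))) = 0 := by rw [dotc_neg_right, hdB, neg_zero]
  have hBq' : ((fun j => ((q) j : ℂ)) ⬝ᵥ (WithLp.ofLp (-(((-Complex.I * conj ((ζ)) * ((‖(ζ)‖⁻¹ : ℝ) : ℂ)) * ((α) : ℂ)) • EuclideanSpace.complexify (B))))) = 0 := by rw [dotc_neg_right, hBq, neg_zero]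
  -- the value of the beat, both signs
  have hbeat : Real.pi * (conj (((fun j => ((q) j : ℂ)) ⬝ᵥ (WithLp.ofLp (((((α) / Real.sqrt (Torus.freqNormSq (q)) : ℝ) : ℂ) • EuclideanSpace.complexify (WithLp.toLp 2 (fun i => ((q) i : ℝ)))))))) *
      ⟪(mFourierCoeff (EuclideanSpace.complexify ∘ (Φ₁.grad 0)) q), (((-Complex.I * conj ((ζ)) * ((‖(ζ)‖⁻¹ : ℝ) : ℂ)) * ((α) : ℂ)) • EuclideanSpace.complexify (B))⟫_ℂ).im ≤
      -(Real.pi * α * α * Real.sqrt (Torus.freqNormSq q) * ‖ζ‖) := by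
    rw [← hGdef, ← hgdef, hζdef]
    exact (beat_value g hq0 α α B (hζdef ▸ hζ0)).le
  have hbeat' : Real.pi * (conj (((fun j => ((q) j : ℂ)) ⬝ᵥ (WithLp.ofLp (-((((α) / Real.sqrt (Torus.freqNormSq (q)) : ℝ) : ℂ) • EuclideanSpace.complexify (WithLp.toLp 2 (fun i => ((q) i : ℝ)))))))) *
      ⟪(mFourierCoeff (EuclideanSpace.complexify ∘ (Φ₁.grad 0)) q), -(((-Complex.I * conj ((ζ)) * ((‖(ζ)‖⁻¹ : ℝ) : ℂ)) * ((α) : ℂ)) • EuclideanSpace.complexify (B))⟫_ℂ).im ≤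
      -(Real.pi * α * α * Real.sqrt (Torus.freqNormSq q) * ‖ζ‖) := by
    rw [dotc_neg_right, map_neg, inner_neg_right, neg_mul_neg]
    exact hbeat
  /- Step 7: the two dressed states and their admissibility. -/
  obtain ⟨up, hup⟩ := exists_state ![p, p + q] ![((((α) / Real.sqrt (Torus.freqNormSq (q)) : ℝ) : ℂ) • EuclideanSpace.complexify (WithLp.toLp 2 (fun i => ((q) i : ℝ)))), (((-Complex.I * conj ((ζ)) * ((‖(ζ)‖⁻¹ : ℝ) : ℂ)) * ((α) : ℂ)) • EuclideanSpace.complexify (B))] (two_ne_zero' hp0 hpq0) (two_dotc hdA hdB)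
  obtain ⟨um, hum⟩ := exists_state ![p, p + q] ![-((((α) / Real.sqrt (Torus.freqNormSq (q)) : ℝ) : ℂ) • EuclideanSpace.complexify (WithLp.toLp 2 (fun i => ((q) i : ℝ)))), -(((-Complex.I * conj ((ζ)) * ((‖(ζ)‖⁻¹ : ℝ) : ℂ)) * ((α) : ℂ)) • EuclideanSpace.complexify (B))] (two_ne_zero' hp0 hpq0) (two_dotc hdA' hdB')
  have hball : (α + α) ^ 2 ≤ 16 * F ^ 2 / ν ^ 2 := by
    rw [hνdef]; exact ball_rest hF hs1 hsB hsc hα2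
  have hup1 : Torus.eGradNormSq (((up : (Torus.energySpace (Fin 3))) : (Lp (EuclideanSpace ℝ (Fin 3)) 2 (volume : Measure (UnitAddTorus (Fin 3))))) : (UnitAddTorus (Fin 3)) → (EuclideanSpace ℝ (Fin 3))) ≠ ⊤ := by
    rw [eGradNormSq_congr_ae' hup]; exact eGradNormSq_modes_ne_top
  have hum1 : Torus.eGradNormSq (((um : (Torus.energySpace (Fin 3))) : (Lp (EuclideanSpace ℝ (Fin 3)) 2 (volume : Measure (UnitAddTorus (Fin 3))))) : (UnitAddTorus (Fin 3)) → (EuclideanSpace ℝ (Fin 3))) ≠ ⊤ := by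
    rw [eGradNormSq_congr_ae' hum]; exact eGradNormSq_modes_ne_top
  have hsum : ∑ m, ‖(![((((α) / Real.sqrt (Torus.freqNormSq (q)) : ℝ) : ℂ) • EuclideanSpace.complexify (WithLp.toLp 2 (fun i => ((q) i : ℝ)))), (((-Complex.I * conj ((ζ)) * ((‖(ζ)‖⁻¹ : ℝ) : ℂ)) * ((α) : ℂ)) • EuclideanSpace.complexify (B))] : Fin 2 → (EuclideanSpace ℂ (Fin 3))) m‖ ≤ α + α := by
    simp only [Fin.sum_univ_two, Matrix.cons_val_zero, Matrix.cons_val_one]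
    linarith
  have hsum0 : 0 ≤ ∑ m, ‖(![((((α) / Real.sqrt (Torus.freqNormSq (q)) : ℝ) : ℂ) • EuclideanSpace.complexify (WithLp.toLp 2 (fun i => ((q) i : ℝ)))), (((-Complex.I * conj ((ζ)) * ((‖(ζ)‖⁻¹ : ℝ) : ℂ)) * ((α) : ℂ)) • EuclideanSpace.complexify (B))] : Fin 2 → (EuclideanSpace ℂ (Fin 3))) m‖ := Finset.sum_nonneg fun m _ => norm_nonneg _
  have hsum' : ∑ m, ‖(![-((((α) / Real.sqrt (Torus.freqNormSq (q)) : ℝ) : ℂ) • EuclideanSpace.complexify (WithLp.toLp 2 (fun i => ((q) i : ℝ)))), -(((-Complex.I * conj ((ζ)) * ((‖(ζ)‖⁻¹ : ℝ) : ℂ)) * ((α) : ℂ)) • EuclideanSpace.complexify (B))] : Fin 2 → (EuclideanSpace ℂ (Fin 3))) m‖ ≤ α + α := by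
    simp only [Fin.sum_univ_two, Matrix.cons_val_zero, Matrix.cons_val_one]
    linarith
  have hsum0' : 0 ≤ ∑ m, ‖(![-((((α) / Real.sqrt (Torus.freqNormSq (q)) : ℝ) : ℂ) • EuclideanSpace.complexify (WithLp.toLp 2 (fun i => ((q) i : ℝ)))), -(((-Complex.I * conj ((ζ)) * ((‖(ζ)‖⁻¹ : ℝ) : ℂ)) * ((α) : ℂ)) • EuclideanSpace.complexify (B))] : Fin 2 → (EuclideanSpace ℂ (Fin 3))) m‖ := Finset.sum_nonneg fun m _ => norm_nonneg _
  have hup2 : ‖up‖ ^ 2 ≤ 16 * (∫ x, ‖f x‖ ^ 2) / ν ^ 2 := by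
    rw [norm_sq_of_ae hup, ← hFsq]
    exact (integral_norm_sq_modes_le.trans (pow_le_pow_left₀ hsum0 hsum 2)).trans hball
  have hum2 : ‖um‖ ^ 2 ≤ 16 * (∫ x, ‖f x‖ ^ 2) / ν ^ 2 := by
    rw [norm_sq_of_ae hum, ← hFsq]
    exact (integral_norm_sq_modes_le.trans (pow_le_pow_left₀ hsum0' hsum' 2)).trans hball
  /- Step 8: the sign choice and the FLOOR at the dressed state. -/
  have hmain : Real.pi * α * α * Real.sqrt (Torus.freqNormSq q) * ‖ζ‖ + ε₀ ≤
      F * (Real.sqrt (∑ κ' ∈ Torus.freqBall N, ‖mFourierCoeff (EuclideanSpace.complexify ∘ (Φ₁.grad 0)) κ'‖ ^ 2)) +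
        (1 + 2 * Θ) * (ν * (4 * Real.pi ^ 2 * (((N ^ 2 + 2 * N + 5 : ℕ)) : ℝ) ^ 2 * (α + α) ^ 2)) := by
    by_cases hP : 0 ≤ ∫ x, ⟪(∑ mm, Torus.realTrigPoly {![p, p + q] mm} (fun _ => ![((((α) / Real.sqrt (Torus.freqNormSq (q)) : ℝ) : ℂ) • EuclideanSpace.complexify (WithLp.toLp 2 (fun i => ((q) i : ℝ)))), (((-Complex.I * conj ((ζ)) * ((‖(ζ)‖⁻¹ : ℝ) : ℂ)) * ((α) : ℂ)) • EuclideanSpace.complexify (B))] mm)) x, f x⟫_ℝ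
    · have hu' := hu up
      dsimp only at hu'
      have hfl := hu' hup1 hup2
      exact floor_beat_at_rest hfs hν hFdef.symm Φ₁ hband hθ₁ hθ₁' up hup hdA hdB hBq hzA hzB hNp hNpq hN5 hLm hbeat hP hfl
    · have hP' : 0 ≤ ∫ x, ⟪(∑ mm, Torus.realTrigPoly {![p, p + q] mm} (fun _ => ![-((((α) / Real.sqrt (Torus.freqNormSq (q)) : ℝ) : ℂ) • EuclideanSpace.complexify (WithLp.toLp 2 (fun i => ((q) i : ℝ)))), -(((-Complex.I * conj ((ζ)) * ((‖(ζ)‖⁻¹ : ℝ) : ℂ)) * ((α) : ℂ)) • EuclideanSpace.complexify (B))] mm)) x, f x⟫_ℝ := by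
        rw [pairing_two_neg hfs.integrable]
        linarith [not_le.1 hP]
      have hu' := hu um
      dsimp only at hu'
      have hfl := hu' hum1 hum2
      exact floor_beat_at_rest hfs hν hFdef.symm Φ₁ hband hθ₁ hθ₁' um hum hdA' hdB' hBq' hzA' hzB' hNp hNpq hN5 hLm hbeat' hP' hfl
  /- Step 9: the endgame. -/
  rw [← hGdef, ← h𝔊def] at hmain
  have e2 : ((((N ^ 2 + 2 * N + 5 : ℕ)) : ℝ)) = (N : ℝ) ^ 2 + 2 * N + 5 := by push_cast; ring
  rw [e2, hνdef] at hmain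
  rw [hΘeq] at hsS
  exact endgame_rest hF hΘ hC'1 hs1 hε₀ hK₃ hsS hN0 hNs hcard1 hcard h𝔊0 hcardq (norm_nonneg g) (norm_nonneg ζ) hgB hfq1 hα2 hmain


end Summit.AnomalousDissipation.AnomalousDissipation.Theorems.KolmogorovFloor.Negative
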